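import Mathlib.Geometry.Euclidean.Inversion.Calculus
import Literature.Geometry.Symplectic.GromovR4RelEnd
import Literature.Topology.FourManifolds.HomotopySpheres
import Literature.Topology.FourManifolds.GluckTwist
import Literature.Geometry.Kaehler.ComplexProjectiveSpaceFubiniStudy
import Summits.SmoothPoincare4.SmoothPoincare4.Theorems.SymplecticOrigamiOrigamiFoldExistenceHelperIsStabilisingRoundContactSphere
import Summits.SmoothPoincare4.SmoothPoincare4.Theorems.SymplecticOrigamiOrigamiFoldExistenceHelperStabilityInvariances

/-!
# Stub `helper_isStabilising_of_roundTrace` (+ rider `helper_stableSeam_of_roundSeam`) of line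
`stable-seam-host` for crux `OrigamiFoldExistence` (item stmt-SmoothPoincare4-7844, route
route-SmoothPoincare4-SymplecticOrigami)

Brick E of the line's ladder, "ROUND ⊂ STABLE": a shell map `g : ℝ⁴ → X` whose seam trace on the
unit sphere `S³ ⊂ ℝ⁴` is ROUND, i.e.

  `Ω (g u) (Dg v, Dg w) = κ² ω₀(A Dι_u v, A Dι_u w)`  (`‖u‖ = 1`, `v, w ⊥ u`),

with `ω₀ = dx₀ ∧ dx₁ + dx₂ ∧ dx₃` the standard symplectic form
(`Literature.Geometry.Symplectic.stdSymplecticForm`), `ι z = z/‖z‖²` the inversion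
(`Literature.Geometry.Symplectic.inversion`), `A` a linear isometry and `κ > 0`, admits a
STABILISING form `θ` in the sense of the line (Cieliebak–Volkov stability of the seam trace,
written orientation-free in the chart): `θ` is `C^∞`, (i) `θ ∧ σ ≠ 0` on every linearly
independent tangent triple `v ⊥ u`, (ii) `ker σ(u)|_{u^⊥} ⊂ ker dθ(u)|_{u^⊥}`.

Proof.  On the unit sphere `Dι_u` is the reflection in `u^⊥` (Mathlib
`EuclideanGeometry.hasFDerivAt_inversion`), so it FIXES tangent vectors: `Dι_u v = v` for `v ⊥ u`
(`fderiv_inversion_apply_of_inner_eq_zero`).  Hence the tangential trace is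
`σ'(u; v, w) = κ² ω₀(A v, A w) = κ² σ₀(A u; A v, A w)` with `σ₀(u'; v', w') = ω₀(v', w')` the round
contact trace, which is stabilised by the standard contact form `θ₀(u) = ½ ω₀(u, ·)`
(`helper_isStabilising_roundContactSphere`); transport along the isometry `A`
(`helper_isStabilising_comp_linearIsometry`: `θ_A(u) = θ₀(A u) ∘ A` stabilises
`(u, v, w) ↦ ω₀(A v, A w)`) and rescale tangentially by `κ² ≠ 0`
(`helper_isStabilising_of_tangential_eq_smul`).

The rider `helper_stableSeam_of_roundSeam` is the bookkeeping consequence `RoundSeam → StableSeam`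
for the line's inlined vocabulary: a round re-embedding `J'` of the fake ball (round trace of
`J' ∘ e` on an annulus `1 - δ < ‖y‖ < 1 + δ`) is a stable one (specialise the annulus clause to
the unit sphere `y := u` and apply the stub to `g := J' ∘ e`).

No definitions, no named facts, no `sorry`.  Sources: K. Cieliebak, E. Volkov, *First steps in
stable Hamiltonian topology*, JEMS 17 (2015), §1 (contact forms stabilise); folklore calculus
(the differential of the inversion on its fixed sphere).
-/

noncomputable section

-- the prescribed namespace `Summit.<P>.<Sub>.…` duplicates `SmoothPoincare4` (P = Sub)
set_option linter.dupNamespace false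

open scoped Manifold ContDiff Topology RealInnerProductSpace
open Set Function

namespace Summit.SmoothPoincare4.SmoothPoincare4.Theorems.OrigamiFoldExistence.StableSeamHost

/-! ### The differential of the inversion on the unit sphere -/

/-- The tree's inversion `ι z = (‖z‖²)⁻¹ • z` of `ℝ⁴` is Mathlib's inversion in the unit sphere
centred at the origin, `EuclideanGeometry.inversion 0 1` (as functions). [folklore] -/
theorem inversion_eq_euclideanInversion :
    (Literature.Geometry.Symplectic.inversion :
        EuclideanSpace ℝ (Fin 4) → EuclideanSpace ℝ (Fin 4))
      = EuclideanGeometry.inversion (0 : EuclideanSpace ℝ (Fin 4)) 1 := by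
  funext z
  simp [Literature.Geometry.Symplectic.inversion, EuclideanGeometry.inversion, div_eq_inv_mul,
    inv_pow]

/-- At a unit vector `u` the inversion `ι` has differential the reflection in the hyperplane
`u^⊥` (Mathlib `EuclideanGeometry.hasFDerivAt_inversion`, with `(1 / dist u 0)² = 1`).
[folklore] -/
theorem hasFDerivAt_inversion_of_norm_eq_one {u : EuclideanSpace ℝ (Fin 4)} (hu : ‖u‖ = 1) :
    HasFDerivAt Literature.Geometry.Symplectic.inversion
      ((ℝ ∙ u)ᗮ.reflection.toContinuousLinearEquiv.toContinuousLinearMap) u := by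
  have hu0 : u ≠ 0 := by
    intro h; rw [h, norm_zero] at hu; exact zero_ne_one hu
  have h := EuclideanGeometry.hasFDerivAt_inversion (c := (0 : EuclideanSpace ℝ (Fin 4)))
    (R := 1) hu0
  rw [← inversion_eq_euclideanInversion] at h
  simpa [hu] using h

/-- **The differential of the inversion fixes tangent vectors of the unit sphere**:
`Dι_u v = v` for `‖u‖ = 1` and `v ⊥ u` (the reflection in `u^⊥` is the identity on `u^⊥`,
`Submodule.reflection_mem_subspace_eq_self`). [folklore] -/
theorem fderiv_inversion_apply_of_inner_eq_zero {u v : EuclideanSpace ℝ (Fin 4)} (hu : ‖u‖ = 1)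
    (hv : ⟪v, u⟫ = 0) : fderiv ℝ Literature.Geometry.Symplectic.inversion u v = v := by
  rw [(hasFDerivAt_inversion_of_norm_eq_one hu).fderiv]
  have hvmem : v ∈ (ℝ ∙ u)ᗮ := Submodule.mem_orthogonal_singleton_iff_inner_left.2 hv
  show (ℝ ∙ u)ᗮ.reflection v = v
  exact Submodule.reflection_mem_subspace_eq_self hvmem

/-! ### The registered signature -/

/-- **A round seam trace is stabilised** ("round ⊂ stable", brick E of line `stable-seam-host`).
If the tangential trace of `Ω` along `g : ℝ⁴ → X` on the unit sphere is
`κ² ω₀(A Dι_u v, A Dι_u w)` (`κ > 0`, `A` a linear isometry, `ι` the inversion), then it admits a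
stabilising form: since `Dι_u = id` on `u^⊥`, the trace is `κ²`-times the isometric transport of
the round contact trace `ω₀(v, w)`, which the standard contact form `½ ω₀(u, ·)` stabilises
(Cieliebak–Volkov, JEMS 17 (2015), §1); stability is invariant under isometric transport and
tangential rescaling. [folklore] -/
theorem helper_isStabilising_of_roundTrace :
    ∀ (X : Type) [TopologicalSpace X] [ChartedSpace (EuclideanSpace ℝ (Fin 4)) X] (Ω : Literature.Geometry.Kaehler.MForm (𝓡 4) X ℝ 2) (g : EuclideanSpace ℝ (Fin 4) → X) (κ : ℝ) (A : EuclideanSpace ℝ (Fin 4) ≃ₗᵢ[ℝ] EuclideanSpace ℝ (Fin 4)), 0 < κ → (∀ u : EuclideanSpace ℝ (Fin 4), ‖u‖ = 1 → ∀ v w : EuclideanSpace ℝ (Fin 4), ⟪v, u⟫ = 0 → ⟪w, u⟫ = 0 → Ω (g u) ![mfderiv (𝓡 4) (𝓡 4) g u v, mfderiv (𝓡 4) (𝓡 4) g u w] = κ ^ 2 * Literature.Geometry.Symplectic.stdSymplecticForm (A (fderiv ℝ Literature.Geometry.Symplectic.inversion u v)) (A (fderiv ℝ Literature.Geometry.Symplectic.inversion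 u w))) → ∃ θ : EuclideanSpace ℝ (Fin 4) → EuclideanSpace ℝ (Fin 4) →L[ℝ] ℝ, (ContDiff ℝ ∞ θ ∧ (∀ u : EuclideanSpace ℝ (Fin 4), ‖u‖ = 1 → ∀ v : Fin 3 → EuclideanSpace ℝ (Fin 4), (∀ i, ⟪v i, u⟫ = 0) → LinearIndependent ℝ v → θ u (v 0) * Ω (g u) ![mfderiv (𝓡 4) (𝓡 4) g u (v 1), mfderiv (𝓡 4) (𝓡 4) g u (v 2)] - θ u (v 1) * Ω (g u) ![mfderiv (𝓡 4) (𝓡 4) g u (v 0), mfderiv (𝓡 4) (𝓡 4) g u (v 2)] + θ u (v 2) * Ω (g u) ![mfderiv (𝓡 4) (𝓡 4) g u (v 0), mfderiv (𝓡 4) (𝓡 4) g u (v 1)] ≠ 0) ∧ (∀ u : EuclideanSpace ℝ (Fin 4), ‖u‖ = 1 → ∀ v : EuclideanSpace ℝ (Fin 4), ⟪v, u⟫ = 0 → (∀ w : EuclideanSpace ℝ (Fin 4), ⟪w, u⟫ = 0 → Ω (g u) ![mfderiv (𝓡 4) (𝓡 4) g u v, mfderiv (𝓡 4) (𝓡 4)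 g u w] = 0) → ∀ w : EuclideanSpace ℝ (Fin 4), ⟪w, u⟫ = 0 → fderiv ℝ θ u v w - fderiv ℝ θ u w v = 0)) := by
  intro X _ _ Ω g κ A hκ hround
  obtain ⟨θ₀, -, hθ₀⟩ := helper_isStabilising_roundContactSphere
  -- transport the round model `(σ₀, θ₀)` along the isometry `A`
  have hA := helper_isStabilising_comp_linearIsometry
    (fun _ v w => Literature.Geometry.Symplectic.stdSymplecticForm v w) θ₀ A hθ₀
  -- rescale tangentially by `κ² ≠ 0`, using `Dι_u v = v` for `v ⊥ u`
  have key := helper_isStabilising_of_tangential_eq_smul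
    (fun _ v w => Literature.Geometry.Symplectic.stdSymplecticForm (A v) (A w))
    (fun u v w => Ω (g u) ![mfderiv (𝓡 4) (𝓡 4) g u v, mfderiv (𝓡 4) (𝓡 4) g u w])
    (fun u => (θ₀ (A u)).comp
      (A.toContinuousLinearEquiv : EuclideanSpace ℝ (Fin 4) →L[ℝ] EuclideanSpace ℝ (Fin 4)))
    (κ ^ 2) (pow_ne_zero 2 hκ.ne') (fun u hu v w hv hw => ?_) hA
  · exact ⟨_, key⟩
  · show Ω (g u) ![mfderiv (𝓡 4) (𝓡 4) g u v, mfderiv (𝓡 4) (𝓡 4) g u w]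
        = κ ^ 2 * Literature.Geometry.Symplectic.stdSymplecticForm (A v) (A w)
    rw [hround u hu v w hv hw, fderiv_inversion_apply_of_inner_eq_zero hu hv,
      fderiv_inversion_apply_of_inner_eq_zero hu hw]

/-! ### Rider: `RoundSeam → StableSeam` -/

/-- **A round seam is a stable seam** (`RoundSeam → StableSeam` in the inlined vocabulary of line
`stable-seam-host`): if every host embedding problem admits a re-embedding `J'` of the fake ball
whose seam trace `Ω (D(J' ∘ e) v, D(J' ∘ e) w) = κ² ω₀(A Dι v, A Dι w)` is round on an annulus
`1 - δ < ‖y‖ < 1 + δ`, then it admits one with a stabilised seam trace on the unit sphere: restrict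
the annulus clause to `‖u‖ = 1` and apply `helper_isStabilising_of_roundTrace` to `g := J' ∘ e`.
[folklore] -/
theorem helper_stableSeam_of_roundSeam :
    (∀ (S : Literature.Topology.FourManifolds.HomotopySphere 4) (e : EuclideanSpace ℝ (Fin 4) → S.carrier) (X : Type) [TopologicalSpace X] [T2Space X] [SecondCountableTopology X] [CompactSpace X] [ChartedSpace (EuclideanSpace ℝ (Fin 4)) X] [IsManifold (𝓡 4) ∞ X] [SimplyConnectedSpace X] (Ω : Literature.Geometry.Kaehler.MForm (𝓡 4) X ℝ 2) (J : S.carrier → X), Manifold.IsSmoothEmbedding (𝓡 4) (𝓡 4) ∞ e → (Literature.Geometry.Kaehler.IsSmoothForm Ω ∧ Literature.Geometry.Kaehler.IsClosedForm Ω ∧ ∀ x (v : TangentSpace (𝓡 4) x), v ≠ 0 → ∃ w, Ω x ![v, w] ≠ 0) → (∃ U : Set S.carrier, IsOpen U ∧ (e '' Metric.ball (0 : EuclideanSpace ℝ (Fin 4)) 1)ᶜ ⊆ U ∧ ContMDiffOn (𝓡 4) (𝓡 4) ∞ J U ∧ Set.InjOn J U ∧ ∀ x ∈ U, Function.Bijective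 (mfderiv (𝓡 4) (𝓡 4) J x)) → ((∃ c c' : (Metric.sphere (0 : EuclideanSpace ℝ (Fin 3)) 1) → X, (Manifold.IsSmoothEmbedding (𝓡 2) (𝓡 4) ∞ c ∧ (∀ y (v : TangentSpace (𝓡 2) y), v ≠ 0 → ∃ w : TangentSpace (𝓡 2) y, Ω (c y) ![mfderiv (𝓡 2) (𝓡 4) c y v, mfderiv (𝓡 2) (𝓡 4) c y w] ≠ 0) ∧ Manifold.IsSmoothEmbedding (𝓡 2) (𝓡 4) ∞ c' ∧ Disjoint (Set.range c) (Set.range c') ∧ ∃ H : unitInterval × (Metric.sphere (0 : EuclideanSpace ℝ (Fin 3)) 1) → X, Continuous H ∧ ∀ y, H (0, y) = c y ∧ H (1, y) = c' y)) ∨ (∃ (Ψ : X ≃ₘ⟮𝓡 4, 𝓡 4⟯ Literature.Topology.FourManifolds.ComplexProjectivePlane) (a : ℝ), 0 < a ∧ ∀ x (v w : TangentSpace (𝓡 4) x), Ω x ![v, w] = a * Literature.Geometry.Kaehler.CPn.fsForm 2 (Ψ x) ![mfderiv (𝓡 4) (𝓡 4) Ψ x v, mfderiv (𝓡 4) (𝓡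 4) Ψ x w])) → ∃ (J' : S.carrier → X) (κ : ℝ) (A : EuclideanSpace ℝ (Fin 4) ≃ₗᵢ[ℝ] EuclideanSpace ℝ (Fin 4)) (δ : ℝ), (∃ U : Set S.carrier, IsOpen U ∧ (e '' Metric.ball (0 : EuclideanSpace ℝ (Fin 4)) 1)ᶜ ⊆ U ∧ ContMDiffOn (𝓡 4) (𝓡 4) ∞ J' U ∧ Set.InjOn J' U ∧ ∀ x ∈ U, Function.Bijective (mfderiv (𝓡 4) (𝓡 4) J' x)) ∧ 0 < κ ∧ 0 < δ ∧ ∀ y : EuclideanSpace ℝ (Fin 4), 1 - δ < ‖y‖ → ‖y‖ < 1 + δ → ∀ v w : EuclideanSpace ℝ (Fin 4), Ω ((J' ∘ e) y) ![mfderiv (𝓡 4) (𝓡 4) (J' ∘ e) y v, mfderiv (𝓡 4) (𝓡 4) (J' ∘ e) y w] = κ ^ 2 * Literature.Geometry.Symplectic.stdSymplecticForm (A (fderiv ℝ Literature.Geometry.Symplectic.inversion y v)) (A (fderiv ℝ Literature.Geometry.Symplectic.inversion y w))) → (∀ (S : Literature.Topology.FourManifolds.HomotopySphere 4) (e : EuclideanSpace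 ℝ (Fin 4) → S.carrier) (X : Type) [TopologicalSpace X] [T2Space X] [SecondCountableTopology X] [CompactSpace X] [ChartedSpace (EuclideanSpace ℝ (Fin 4)) X] [IsManifold (𝓡 4) ∞ X] [SimplyConnectedSpace X] (Ω : Literature.Geometry.Kaehler.MForm (𝓡 4) X ℝ 2) (J : S.carrier → X), Manifold.IsSmoothEmbedding (𝓡 4) (𝓡 4) ∞ e → (Literature.Geometry.Kaehler.IsSmoothForm Ω ∧ Literature.Geometry.Kaehler.IsClosedForm Ω ∧ ∀ x (v : TangentSpace (𝓡 4) x), v ≠ 0 → ∃ w, Ω x ![v, w] ≠ 0) → (∃ U : Set S.carrier, IsOpen U ∧ (e '' Metric.ball (0 : EuclideanSpace ℝ (Fin 4)) 1)ᶜ ⊆ U ∧ ContMDiffOn (𝓡 4) (𝓡 4) ∞ J U ∧ Set.InjOn J U ∧ ∀ x ∈ U, Function.Bijective (mfderiv (𝓡 4) (𝓡 4) J x)) → ((∃ c c' : (Metric.sphere (0 : EuclideanSpace ℝ (Fin 3)) 1) → X, (Manifold.IsSmoothEmbedding (𝓡 2) (𝓡 4) ∞ c ∧ (∀ y (v : TangentSpace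 (𝓡 2) y), v ≠ 0 → ∃ w : TangentSpace (𝓡 2) y, Ω (c y) ![mfderiv (𝓡 2) (𝓡 4) c y v, mfderiv (𝓡 2) (𝓡 4) c y w] ≠ 0) ∧ Manifold.IsSmoothEmbedding (𝓡 2) (𝓡 4) ∞ c' ∧ Disjoint (Set.range c) (Set.range c') ∧ ∃ H : unitInterval × (Metric.sphere (0 : EuclideanSpace ℝ (Fin 3)) 1) → X, Continuous H ∧ ∀ y, H (0, y) = c y ∧ H (1, y) = c' y)) ∨ (∃ (Ψ : X ≃ₘ⟮𝓡 4, 𝓡 4⟯ Literature.Topology.FourManifolds.ComplexProjectivePlane) (a : ℝ), 0 < a ∧ ∀ x (v w : TangentSpace (𝓡 4) x), Ω x ![v, w] = a * Literature.Geometry.Kaehler.CPn.fsForm 2 (Ψ x) ![mfderiv (𝓡 4) (𝓡 4) Ψ x v, mfderiv (𝓡 4) (𝓡 4) Ψ x w])) → ∃ (J' : S.carrier → X) (θ : EuclideanSpace ℝ (Fin 4) → EuclideanSpace ℝ (Fin 4) →L[ℝ] ℝ), (∃ U : Set S.carrier, IsOpen U ∧ (e '' Metric.ball (0 : EuclideanSpace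 ℝ (Fin 4)) 1)ᶜ ⊆ U ∧ ContMDiffOn (𝓡 4) (𝓡 4) ∞ J' U ∧ Set.InjOn J' U ∧ ∀ x ∈ U, Function.Bijective (mfderiv (𝓡 4) (𝓡 4) J' x)) ∧ (ContDiff ℝ ∞ θ ∧ (∀ u : EuclideanSpace ℝ (Fin 4), ‖u‖ = 1 → ∀ v : Fin 3 → EuclideanSpace ℝ (Fin 4), (∀ i, ⟪v i, u⟫ = 0) → LinearIndependent ℝ v → θ u (v 0) * Ω ((J' ∘ e) u) ![mfderiv (𝓡 4) (𝓡 4) (J' ∘ e) u (v 1), mfderiv (𝓡 4) (𝓡 4) (J' ∘ e) u (v 2)] - θ u (v 1) * Ω ((J' ∘ e) u) ![mfderiv (𝓡 4) (𝓡 4) (J' ∘ e) u (v 0), mfderiv (𝓡 4) (𝓡 4) (J' ∘ e) u (v 2)] + θ u (v 2) * Ω ((J' ∘ e) u) ![mfderiv (𝓡 4) (𝓡 4) (J' ∘ e) u (v 0), mfderiv (𝓡 4) (𝓡 4) (J' ∘ e) u (v 1)] ≠ 0) ∧ (∀ u : EuclideanSpace ℝ (Fin 4), ‖u‖ = 1 →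 ∀ v : EuclideanSpace ℝ (Fin 4), ⟪v, u⟫ = 0 → (∀ w : EuclideanSpace ℝ (Fin 4), ⟪w, u⟫ = 0 → Ω ((J' ∘ e) u) ![mfderiv (𝓡 4) (𝓡 4) (J' ∘ e) u v, mfderiv (𝓡 4) (𝓡 4) (J' ∘ e) u w] = 0) → ∀ w : EuclideanSpace ℝ (Fin 4), ⟪w, u⟫ = 0 → fderiv ℝ θ u v w - fderiv ℝ θ u w v = 0))) := by
  intro hR S e X _ _ _ _ _ _ _ Ω J he hΩ hJ hX
  obtain ⟨J', κ, A, δ, hJ', hκ, hδ, hround⟩ := hR S e X Ω J he hΩ hJ hX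
  obtain ⟨θ, hθ⟩ := helper_isStabilising_of_roundTrace X Ω (J' ∘ e) κ A hκ
    (fun u hu v w _ _ => hround u (by linarith) (by linarith) v w)
  exact ⟨J', θ, hJ', hθ⟩

end Summit.SmoothPoincare4.SmoothPoincare4.Theorems.OrigamiFoldExistence.StableSeamHost

end
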